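import Summits.CriticalPhenomena.Ising3DConformalLimit.Theses.ReflectionTwin
import Summits.CriticalPhenomena.Ising3DConformalLimit.Theorems.HyperoctahedralRPLimitRotationInvariant
import Summits.CriticalPhenomena.Ising3DConformalLimit.Theorems.HyperoctahedralRPHRP2Rigidity
import HarnessLib

/-!
# `TwinRotationGlue` (item stmt-CriticalPhenomena-16913) is a corollary of the tree — candidate proof for a PROVER

Crux workfile `Cruxes/TwinRotationGlue/TreeProof.lean` (planner-skel-stmt-CriticalPhenomena-16913-0, 2026-08-17;
a planner does not land Theorems — this file is the evidence / the text to land).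

The crux `ReflectionTwin.TwinRotationGlue` asks: for every normalised, continuous-on-`NonCoincident`,
non-degenerate, translation-invariant, scale-covariant pointwise limit `(ρ, Δ, S)` of `criticalCorr 3`, blind
transparency of the (111) reflection twin implies `IsRotationInvariant S`.  But isotropy of EVERY such limit is
already a theorem of the tree, with no twin and no continuity hypothesis:

* item 1980 `HyperoctahedralRP.LimitRotationInvariant` — `Cruxes.LimitRotationInvariant.QuarterTurnLiouville.LimitRotationInvariant_of`
  (`Theorems/HyperoctahedralRPLimitRotationInvariant.lean`, commit b509d2f177bd): `HRP2Rigidity →` every normalised,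
  non-degenerate, translation-invariant, scale-covariant pointwise limit of `criticalCorr 3` is `O(3)`-invariant;
* item 1979 `HyperoctahedralRP.HRP2Rigidity` — `Cruxes.HRP2Rigidity.XRayMellin.HRP2Rigidity_of`
  (`Theorems/HyperoctahedralRPHRP2Rigidity.lean`).

So the crux follows by instantiation (below: `lean check` rc 0, no `sorry`, axioms `propext`, `Classical.choice`,
`Quot.sound`).  TO CLOSE THE ITEM: copy this theorem into
`Summits/CriticalPhenomena/Ising3DConformalLimit/Theorems/ReflectionTwinTwinRotationGlue.lean` and
`ledger propose --kind proof --target …/Theorems/ReflectionTwinTwinRotationGlue.lean --workitem stmt-CriticalPhenomena-16913`.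
The registered skeleton `Lines/birth.lean` (the route's OWN four-support mechanism) is then unnecessary for the
crux; its stubs remain the route's support items 16908–16910 (dividends of the line, not prerequisites).
-/

noncomputable section

open Literature.Probability.LatticeModels

namespace Summit.CriticalPhenomena.Ising3DConformalLimit.Cruxes.TwinRotationGlue.TreeProof

/-- **`ReflectionTwin.TwinRotationGlue` from the tree** (items 1980 ∘ 1979), ignoring the twin-transparency
witness and the continuity hypothesis: every normalised, non-degenerate, translation-invariant, scale-covariant
pointwise limit of the critical `ℤ³` correlators is `O(3)`-invariant. [cite: DuminilCopinICM2022, §8.1 (8.1)–(8.3)] -/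
theorem twinRotationGlue_of_tree :
    Summit.CriticalPhenomena.Ising3DConformalLimit.Theses.ReflectionTwin.TwinRotationGlue := by
  intro ρ Δ S hρ hlim hnorm _hcont hnd htr hsc _hex
  exact Summit.CriticalPhenomena.Ising3DConformalLimit.Cruxes.LimitRotationInvariant.QuarterTurnLiouville.LimitRotationInvariant_of
    Summit.CriticalPhenomena.Ising3DConformalLimit.Cruxes.HRP2Rigidity.XRayMellin.HRP2Rigidity_of
    ρ Δ S hρ hlim hnorm hnd htr hsc

end Summit.CriticalPhenomena.Ising3DConformalLimit.Cruxes.TwinRotationGlue.TreeProof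

end
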